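import Summits.CriticalPhenomena.PercolationContinuityZ3.Theorems.SahiMasterFamilyPointwise
import Summits.CriticalPhenomena.PercolationContinuityZ3.Theorems.SahiMasterFamilyShrunkFrameZeros
import Summits.CriticalPhenomena.PercolationContinuityZ3.Theorems.PercNearOneGluingNoHeavyLowerTailSahiCombMixCoord
import Summits.CriticalPhenomena.PercolationContinuityZ3.Theorems.SahiMasterFamilyRigidityAllSections

/-!
# A minimal counterexample to Kahn's Conjecture 5 has a negative one-coordinate Bernstein coefficient at EVERY coordinate

Unit `prim-master-conj` (crux anchor stmt-CriticalPhenomena-4575, helper work), gen 14; memo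
`run/shared/lean/prim/prim-l12/prim-master-conj/POINTWISE.md` §15.

Along one coordinate `e` an increasing triple `U` is `U_j = mixCoord e (U_j^{e←0}) (U_j^{e←1})` (`mixCoord_secAt_eq`), and P3's generic three-slot cell
(`SahiCombMix.sahiE_three_mixCoord_eq`) writes
  `E_3(μ_p; 1_U) = (1−t)³·E_3(U^{e←0}) + t(1−t)²·mixC1_e + t²(1−t)·mixC2_e + t³·E_3(U^{e←1})`,  `t = p_e`,
with `mixC1_e, mixC2_e` the two mixed (two-level) functionals of the six sections, evaluated at `μ_p`.  Hence, by induction on the size of a determining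
set, **Kahn's Conjecture 5 / Sahi's `C_3` for product measures follows from the existence, for every triple and every parameter, of ONE coordinate of a
determining set whose two mixed coefficients are `≥ 0`** (`masterFamilyNonneg_three_of_bernsteinGoodCoordinate`; hypothesis `BernsteinGoodCoordinate`,
spelled out inline — NOT asserted).  Contrapositive: a counterexample to `C_3` with a determining set of minimal size has `mixC1_e < 0 ∨ mixC2_e < 0` at
EVERY coordinate `e` of that set (`exists_neg_mixC_of_minimal`).  (The much stronger (M⁺-3) says all these coefficients are comb-positive; the CHORD analogue
"∃ e with `E_3(U) ≥ (1−t)E_3(U^{e←0}) + tE_3(U^{e←1})`" is FALSE — hexagon example in the memo — so the two-level functionals cannot be bypassed.)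
HONEST FRAMING: a reduction; `C_3` and the hypothesis remain OPEN.  Axioms standard. [this work]
-/

noncomputable section

open scoped Classical

namespace Summit.CriticalPhenomena.PercolationContinuityZ3.Theorems

open Finset Function
open Literature.Combinatorics.Sahi2008
open Literature.Probability.Percolation (DeterminedBy determinedBy_iff)
open Literature.Probability.Percolation.DecisionTree (ind)
open SahiCombMix

namespace Pointwise

variable {ι : Type} [Fintype ι]

/-! ### 1. An increasing event is the `mixCoord` of its two sections -/

omit [Fintype ι] in
/-- Forcing twice keeps the last value. [folklore] -/
theorem forceAt_forceAt (e : ι) (b b' : Bool) (ω : Set ι) : forceAt e b (forceAt e b' ω) = forceAt e b ω := by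
  cases b <;> cases b' <;> simp [forceAt]

omit [Fintype ι] in
/-- Sections are stable under sectioning again at the same coordinate. [folklore] -/
theorem secAt_secAt_same (e : ι) (b b' : Bool) (A : Set (Set ι)) : secAt e b (secAt e b' A) = secAt e b' A := by
  ext ω
  rw [mem_secAt, mem_secAt, mem_secAt, forceAt_forceAt]

omit [Fintype ι] in
/-- **An increasing event is recovered from its two `e`-sections**: `A = A^{e←0} ∪ ({e ∈ ω} ∩ A^{e←1})`. [this work] -/
theorem mixCoord_secAt_eq (e : ι) {A : Set (Set ι)} (hA : IsUpperSet A) : mixCoord e (secAt e false A) (secAt e true A) = A := by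
  ext ω
  rw [mem_mixCoord, mem_secAt, mem_secAt]
  constructor
  · rintro (h | ⟨he, h⟩)
    · exact hA (by simp [forceAt]) h
    · rwa [forceAt_of_iff (b := true) (by simpa using he)] at h
  · intro h
    by_cases he : e ∈ ω
    · exact Or.inr ⟨he, by rwa [forceAt_of_iff (b := true) (by simpa using he)]⟩
    · exact Or.inl (by rwa [forceAt_of_iff (b := false) (by simpa using he)])

/-! ### 2. The one-coordinate Bernstein form of an arbitrary increasing triple -/

/-- **`E_3` of an increasing triple in Bernstein form along `p_e`** (P3's generic cell applied to the sections). [this work] -/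
theorem sahiE_three_bernstein_secAt (e : ι) (U : Fin 3 → Set (Set ι)) (hU : ∀ j, IsUpperSet (U j)) (p : ι → unitInterval) :
    sahiE (bernoulliWeight p) 3 (fun j => ind (U j))
      = (1 - (p e : ℝ)) ^ 3 * sahiE (bernoulliWeight p) 3 (fun j => ind (secAt e false (U j)))
        + (p e : ℝ) * (1 - (p e : ℝ)) ^ 2 * mixC1 (bernoulliWeight p) (fun j => secAt e false (U j)) (fun j => secAt e true (U j))
        + (p e : ℝ) ^ 2 * (1 - (p e : ℝ)) * mixC2 (bernoulliWeight p) (fun j => secAt e false (U j)) (fun j => secAt e true (U j))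
        + (p e : ℝ) ^ 3 * sahiE (bernoulliWeight p) 3 (fun j => ind (secAt e true (U j))) := by
  have h := sahiE_three_mixCoord_eq e (fun j => secAt e false (U j)) (fun j => secAt e true (U j))
    (fun j b => secAt_secAt_same e b false (U j)) (fun j b => secAt_secAt_same e b true (U j))
    (fun j => RigidityAll.secAt_false_subset_secAt_true e (hU j)) p
  have hfam : (fun j => ind (mixCoord e (secAt e false (U j)) (secAt e true (U j)))) = fun j => ind (U j) := by
    funext j; rw [mixCoord_secAt_eq e (hU j)]
  rw [hfam] at h
  exact h

/-! ### 3. Events determined by the empty set -/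

omit [Fintype ι] in
/-- An event determined by no coordinate is `∅` or everything. [folklore] -/
theorem eq_empty_or_univ_of_determinedBy_empty {A : Set (Set ι)} (hA : DeterminedBy A ((∅ : Finset ι) : Set ι)) : A = ∅ ∨ A = Set.univ := by
  rw [determinedBy_iff] at hA
  by_cases hne : A.Nonempty
  · obtain ⟨ω₀, hω₀⟩ := hne
    exact Or.inr (Set.eq_univ_of_forall fun ω => (hA ω₀ ω (by simp)).1 hω₀)
  · exact Or.inl (Set.not_nonempty_iff_eq_empty.1 hne)

/-- A triple determined by no coordinate is a zero flag (hence `E_3 = 0`). [this work] -/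
theorem suppZeroFlag_three_of_determinedBy_empty (U : Fin 3 → Set (Set ι)) (hU : ∀ j, DeterminedBy (U j) ((∅ : Finset ι) : Set ι)) :
    SuppZeroFlag 3 U := by
  by_cases h : ∃ j, U j = ∅
  · obtain ⟨j, hj⟩ := h
    exact suppZeroFlag_of_mem_empty 2 U j hj
  · push Not at h
    exact suppZeroFlag_of_pairwise_disjoint 1 U (fun _ => ∅) (fun _ _ _ => disjoint_bot_left) hU

/-! ### 4. The reduction -/

/-- **`C_3` from a Bernstein-good coordinate.**  If for every finite cube, every interior-or-not parameter `p`, every increasing triple `U` and every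
NONEMPTY determining set `S` of `U` there is a coordinate `e ∈ S` at which both mixed Bernstein coefficients of `U` along `e` are `≥ 0` at `p`, then
Sahi's `C_3` holds for product measures (`MasterFamilyNonneg 3` = Kahn's Conjecture 5). [this work] -/
theorem masterFamilyNonneg_three_of_bernsteinGoodCoordinate
    (BGC : ∀ (κ : Type) [Fintype κ] (p : κ → unitInterval) (U : Fin 3 → Set (Set κ)), (∀ j, IsUpperSet (U j)) →
      ∀ S : Finset κ, (∀ j, DeterminedBy (U j) (↑S : Set κ)) → S.Nonempty →
        ∃ e ∈ S, 0 ≤ mixC1 (bernoulliWeight p) (fun j => secAt e false (U j)) (fun j => secAt e true (U j)) ∧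
          0 ≤ mixC2 (bernoulliWeight p) (fun j => secAt e false (U j)) (fun j => secAt e true (U j))) :
    MasterFamilyNonneg 3 := by
  intro κ _ p U hU
  -- induction on the size of a determining set
  suffices key : ∀ (m : ℕ) (V : Fin 3 → Set (Set κ)) (S : Finset κ), S.card = m → (∀ j, IsUpperSet (V j)) →
      (∀ j, DeterminedBy (V j) (↑S : Set κ)) → 0 ≤ sahiE (bernoulliWeight p) 3 (fun j => ind (V j)) from
    key _ U Finset.univ rfl hU fun j => (determinedBy_iff _ _).2 fun ω ω' h => by
      rw [Finset.coe_univ, Set.inter_univ, Set.inter_univ] at h; rw [h]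
  intro m
  induction m using Nat.strong_induction_on with
  | _ m ih =>
  intro V S hS hV hVS
  rcases S.eq_empty_or_nonempty with hSe | hSne
  · subst hSe
    exact (masterFamilyEqIff_mpr 3 κ p V (suppZeroFlag_three_of_determinedBy_empty V hVS)).ge
  · obtain ⟨e, heS, h1, h2⟩ := BGC κ p V hV S hVS hSne
    have hlt : (S.erase e).card < m := by rw [← hS]; exact Finset.card_erase_lt_of_mem heS
    have E0 := ih _ hlt (fun j => secAt e false (V j)) (S.erase e) rfl (fun j => isUpperSet_secAt e false (hV j))
      (fun j => determinedBy_secAt e false (hVS j))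
    have E1 := ih _ hlt (fun j => secAt e true (V j)) (S.erase e) rfl (fun j => isUpperSet_secAt e true (hV j))
      (fun j => determinedBy_secAt e true (hVS j))
    rw [sahiE_three_bernstein_secAt e V hV p]
    have ht0 : 0 ≤ (p e : ℝ) := (p e).2.1
    have ht1 : 0 ≤ 1 - (p e : ℝ) := sub_nonneg.2 (p e).2.2
    have := mul_nonneg (mul_nonneg ht0 (pow_nonneg ht1 2)) h1
    have := mul_nonneg (mul_nonneg (pow_nonneg ht0 2) ht1) h2
    have := mul_nonneg (pow_nonneg ht1 3) E0
    have := mul_nonneg (pow_nonneg ht0 3) E1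
    linarith

/-- **Contrapositive, local form**: if `C_3` fails for an increasing triple `U` at `p`, and `S` is a determining set of `U` such that `C_3` holds at `p` for
every increasing triple determined by a proper subset `S.erase e` (`e ∈ S`) — e.g. `S` of minimal size among counterexamples — then at EVERY `e ∈ S` one of
the two mixed Bernstein coefficients of `U` along `e` is negative. [this work] -/
theorem exists_neg_mixC_of_minimal (p : ι → unitInterval) (U : Fin 3 → Set (Set ι)) (hU : ∀ j, IsUpperSet (U j)) (S : Finset ι)
    (hmin : ∀ e ∈ S, ∀ V : Fin 3 → Set (Set ι), (∀ j, IsUpperSet (V j)) → (∀ j, DeterminedBy (V j) (↑(S.erase e) : Set ι)) →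
      0 ≤ sahiE (bernoulliWeight p) 3 (fun j => ind (V j)))
    (hUS : ∀ j, DeterminedBy (U j) (↑S : Set ι)) (hneg : sahiE (bernoulliWeight p) 3 (fun j => ind (U j)) < 0) :
    ∀ e ∈ S, mixC1 (bernoulliWeight p) (fun j => secAt e false (U j)) (fun j => secAt e true (U j)) < 0 ∨
      mixC2 (bernoulliWeight p) (fun j => secAt e false (U j)) (fun j => secAt e true (U j)) < 0 := by
  intro e heS
  by_contra hcon
  push Not at hcon
  obtain ⟨h1, h2⟩ := hcon
  have E0 := hmin e heS (fun j => secAt e false (U j)) (fun j => isUpperSet_secAt e false (hU j)) fun j => determinedBy_secAt e false (hUS j)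
  have E1 := hmin e heS (fun j => secAt e true (U j)) (fun j => isUpperSet_secAt e true (hU j)) fun j => determinedBy_secAt e true (hUS j)
  rw [sahiE_three_bernstein_secAt e U hU p] at hneg
  have ht0 : 0 ≤ (p e : ℝ) := (p e).2.1
  have ht1 : 0 ≤ 1 - (p e : ℝ) := sub_nonneg.2 (p e).2.2
  have := mul_nonneg (mul_nonneg ht0 (pow_nonneg ht1 2)) h1
  have := mul_nonneg (mul_nonneg (pow_nonneg ht0 2) ht1) h2
  have := mul_nonneg (pow_nonneg ht1 3) E0
  have := mul_nonneg (pow_nonneg ht0 3) E1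
  linarith

/-! ### 5. Class-relative form -/

/-- **Class-relative reduction.**  Let `𝒞` be a class of increasing triples on a fixed cube and `p` a parameter.  If every `U ∈ 𝒞` with a NONEMPTY
determining set `S` has a coordinate `e ∈ S` whose two mixed Bernstein coefficients at `p` are `≥ 0` AND whose two `e`-sections lie in `𝒞` again, then
`E_3(μ_p; 1_U) ≥ 0` for every `U ∈ 𝒞` (the induction never leaves `𝒞`).  With `𝒞 = everything` this is `masterFamilyNonneg_three_of_bernsteinGoodCoordinate`.
[this work] -/
theorem sahiE_three_ind_nonneg_on_class_of_bernsteinGoodCoordinate (p : ι → unitInterval) (𝒞 : (Fin 3 → Set (Set ι)) → Prop)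
    (h𝒞 : ∀ U, 𝒞 U → ∀ j, IsUpperSet (U j))
    (BGC : ∀ U, 𝒞 U → ∀ S : Finset ι, (∀ j, DeterminedBy (U j) (↑S : Set ι)) → S.Nonempty →
      ∃ e ∈ S, 0 ≤ mixC1 (bernoulliWeight p) (fun j => secAt e false (U j)) (fun j => secAt e true (U j)) ∧
        0 ≤ mixC2 (bernoulliWeight p) (fun j => secAt e false (U j)) (fun j => secAt e true (U j)) ∧
        𝒞 (fun j => secAt e false (U j)) ∧ 𝒞 (fun j => secAt e true (U j)))
    (U : Fin 3 → Set (Set ι)) (hU : 𝒞 U) : 0 ≤ sahiE (bernoulliWeight p) 3 (fun j => ind (U j)) := by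
  suffices key : ∀ (m : ℕ) (V : Fin 3 → Set (Set ι)) (S : Finset ι), S.card = m → 𝒞 V →
      (∀ j, DeterminedBy (V j) (↑S : Set ι)) → 0 ≤ sahiE (bernoulliWeight p) 3 (fun j => ind (V j)) from
    key _ U Finset.univ rfl hU fun j => (determinedBy_iff _ _).2 fun ω ω' h => by
      rw [Finset.coe_univ, Set.inter_univ, Set.inter_univ] at h; rw [h]
  intro m
  induction m using Nat.strong_induction_on with
  | _ m ih =>
  intro V S hS hV hVS
  rcases S.eq_empty_or_nonempty with hSe | hSne
  · subst hSe
    exact (masterFamilyEqIff_mpr 3 ι p V (suppZeroFlag_three_of_determinedBy_empty V hVS)).ge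
  · obtain ⟨e, heS, h1, h2, h𝒞0, h𝒞1⟩ := BGC V hV S hVS hSne
    have hlt : (S.erase e).card < m := by rw [← hS]; exact Finset.card_erase_lt_of_mem heS
    have E0 := ih _ hlt (fun j => secAt e false (V j)) (S.erase e) rfl h𝒞0 (fun j => determinedBy_secAt e false (hVS j))
    have E1 := ih _ hlt (fun j => secAt e true (V j)) (S.erase e) rfl h𝒞1 (fun j => determinedBy_secAt e true (hVS j))
    rw [sahiE_three_bernstein_secAt e V (h𝒞 V hV) p]
    have ht0 : 0 ≤ (p e : ℝ) := (p e).2.1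
    have ht1 : 0 ≤ 1 - (p e : ℝ) := sub_nonneg.2 (p e).2.2
    have := mul_nonneg (mul_nonneg ht0 (pow_nonneg ht1 2)) h1
    have := mul_nonneg (mul_nonneg (pow_nonneg ht0 2) ht1) h2
    have := mul_nonneg (pow_nonneg ht1 3) E0
    have := mul_nonneg (pow_nonneg ht0 3) E1
    linarith

end Pointwise

end Summit.CriticalPhenomena.PercolationContinuityZ3.Theorems
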